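import Summits.AtomisticToContinuum.Crystallization.Theorems.ShellsToLayers.Negative.UniformTauLattice
import Summits.AtomisticToContinuum.Crystallization.Theorems.ShellsToLayers.Negative.UniformTauNoWindow
import Literature.MathematicalPhysics.StatisticalMechanics.LocalMatchingCompactness

/-!
# `ShellsToLayers` (stmt-AtomisticToContinuum-17254): the tolerance must shrink with `(R, ε)`

Negative lemma on a load-bearing feature of the crux `SpectralChargeLedger.ShellsToLayers`
(route `route-AtomisticToContinuum-SpectralChargeLedger`): its quantifier order
`∀ R ε, ∃ τ R', …`. The **uniform-tolerance strengthening** `ShellsToLayersUniformTau` — the same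
statement with `∃ τ R'` moved in front of `∀ R ε` ("one tolerance `τ > 0` serves every window
scale") — is FALSE (`shellsToLayers_false_uniformTau`). Hence any proof of the crux must let
`τ → 0` as `R → ∞` / `ε → 0` (compactness in `τ` at fixed `(R, ε)`), exactly as the planner's
`why_might_fail` anticipated; a fixed-tolerance local criterion cannot give the window.

## Witness
At `a₀ = 1`, `h₀ = √(2/3)` (ideal ratio, inside the box), `δ = 1/2`: given `τ ∈ (0, 1]` and `R'`, put
`λ = 1 - τ/40` and let `y` enumerate the compressed fcc chunk `λ • (fcc ∩ B̄(0, max R' 0/λ + 2))`.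
* fcc at the ideal ratio is the lattice `ℤu + ℤv + ℤ(w + h₀e₃)` with `‖i u + j v + k (w + h₀ e₃)‖² =
  i² + j² + k² + ij + jk + ki ∈ ℕ` (`fcc_norm_sq`), so its vectors of squared norm `< 2` are `0` and
  the twelve unit vectors (`fcc_short`); consequently every site within `R'` of the centre has its
  punctured `13/10`-shell equal to `λ`× the fcc twelve-shell, pointwise within `(1-λ)·13/10 ≤ τ`
  of the model fcc shell (`good_scaled`): the hypothesis of the crux holds with the GIVEN `τ`.
* but for `R = 10`, `ε = τ/160` no window exists (`no_window`): the layered set `S` of any window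
  has two in-layer neighbours `A v₀, A(v₀ + u)` of norm `≤ 3` (reduce the label modulo `3w = u + v`
  and pick the layer height nearest `0`, `exists_index_abs_le_one`), at distance exactly `1`; they
  are `ε`-matched to two configuration points at distance `λ D` with `D` an fcc distance and
  `|λ D - 1| ≤ 2ε`, forcing `1 < D < √2` — impossible.

So `τ` uniform in `(R, ε)` fails already for perfect (compressed) crystals: the window pins the
in-layer spacing to `a₀` exactly, and a relative compression `s` is invisible to `τ`-matched shells
(`τ ≥ 13 s a₀/10`) but visible to `ε`-windows once `R s ≳ ε`.
-/

noncomputable section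

open Literature.MathematicalPhysics.StatisticalMechanics Metric Set

namespace Summit.AtomisticToContinuum.Crystallization.Theorems.ShellsToLayers.Negative


/-- **The uniform-tolerance strengthening of `ShellsToLayers` is false**: one cannot choose
`τ, R'` depending on `(a₀, h₀, δ)` only and serve every window scale `(R, ε)`. This is
`SpectralChargeLedger.ShellsToLayers` with `∃ τ R' : ℝ, 0 < τ ∧ τ ≤ 1 ∧` moved in front of
`∀ R ε : ℝ, 0 < ε →`, everything else verbatim. Witness: compressed ideal fcc chunks (module
docstring). [folklore] -/
theorem shellsToLayers_false_uniformTau : ¬ (∀ a₀ h₀ : ℝ, 47 / 50 ≤ a₀ → a₀ ≤ 1 → |h₀ - a₀ * Real.sqrt (2 / 3)| ≤ a₀ / 100 → ∀ δ : ℝ, 0 < δ → ∃ τ R' : ℝ, 0 < τ ∧ τ ≤ 1 ∧ ∀ R ε : ℝ, 0 < ε → ∀ (N : ℕ) (y : Fin N → EuclideanSpace ℝ (Fin 3)), (∀ i j : Fin N, i ≠ j → δ ≤ dist (y i) (y j)) → ∀ i : Fin N, (∀ j : Fin N, dist (y j) (y i) ≤ R' → (∃ A : EuclideanSpace ℝ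 (Fin 3) →ₗᵢ[ℝ] EuclideanSpace ℝ (Fin 3), (∃ e : ↥{z : EuclideanSpace ℝ (Fin 3) | z ∈ Set.range y ∧ z ≠ y j ∧ dist z (y j) < 13 / 10 * a₀} ≃ ↥{p : EuclideanSpace ℝ (Fin 3) | p ∈ Literature.MathematicalPhysics.StatisticalMechanics.hcpStacking a₀ h₀ ∧ p ≠ 0 ∧ ‖p‖ < 13 / 10 * a₀}, ∀ t : ↥{z : EuclideanSpace ℝ (Fin 3) | z ∈ Set.range y ∧ z ≠ y j ∧ dist z (y j) < 13 / 10 * a₀}, dist ((t : EuclideanSpace ℝ (Fin 3)) - y j) (A ((e t : ↥{p : EuclideanSpace ℝ (Fin 3) | p ∈ Literature.MathematicalPhysics.StatisticalMechanics.hcpStacking a₀ h₀ ∧ p ≠ 0 ∧ ‖p‖ < 13 / 10 * a₀}) : EuclideanSpace ℝ (Fin 3))) ≤ τ) ∨ (∃ e : ↥{z : EuclideanSpace ℝ (Fin 3) | z ∈ Set.range y ∧ z ≠ y j ∧ dist z (y j) < 13 / 10 * a₀} ≃ ↥{p : EuclideanSpace ℝ (Fin 3) | p ∈ Literature.MathematicalPhysics.StatisticalMechanics.fccStacking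 a₀ h₀ ∧ p ≠ 0 ∧ ‖p‖ < 13 / 10 * a₀}, ∀ t : ↥{z : EuclideanSpace ℝ (Fin 3) | z ∈ Set.range y ∧ z ≠ y j ∧ dist z (y j) < 13 / 10 * a₀}, dist ((t : EuclideanSpace ℝ (Fin 3)) - y j) (A ((e t : ↥{p : EuclideanSpace ℝ (Fin 3) | p ∈ Literature.MathematicalPhysics.StatisticalMechanics.fccStacking a₀ h₀ ∧ p ≠ 0 ∧ ‖p‖ < 13 / 10 * a₀}) : EuclideanSpace ℝ (Fin 3))) ≤ τ))) → ∃ (A : EuclideanSpace ℝ (Fin 3) →ₗᵢ[ℝ] EuclideanSpace ℝ (Fin 3)) (t : EuclideanSpace ℝ (Fin 3)) (s : ℤ → ℤ) (z : ℤ → ℝ), Literature.MathematicalPhysics.StatisticalMechanics.IsHaggSeq s ∧ (∀ m : ℤ, 39 / 50 * a₀ ≤ z (m + 1) - z m ∧ z (m + 1) - z m ≤ 17 / 20 * a₀) ∧ let S : Set (EuclideanSpace ℝ (Fin 3)) := {p | ∃ m i j : ℤ, p = A (((i : ℝ) • Literature.MathematicalPhysics.StatisticalMechanics.triangularVec₁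 a₀) + ((j : ℝ) • Literature.MathematicalPhysics.StatisticalMechanics.triangularVec₂ a₀) + ((Literature.MathematicalPhysics.StatisticalMechanics.haggLabel s m : ℝ) • Literature.MathematicalPhysics.StatisticalMechanics.barlowOffset a₀) + (z m • Literature.MathematicalPhysics.StatisticalMechanics.layerNormal 1))}; (∀ p ∈ S, ‖p‖ ≤ R → ∃ k : Fin N, dist (y k + t) p ≤ ε) ∧ (∀ k : Fin N, ‖y k + t‖ ≤ R → ∃ p ∈ S, dist (y k + t) p ≤ ε)) := by
  intro H
  obtain ⟨τ, R', hτ, hτ1, H⟩ :=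
    H 1 (Real.sqrt (2 / 3)) (by norm_num) le_rfl (by simp) (1 / 2) (by norm_num)
  -- constants: compression `λ = 1 - τ/40`, window scale `(R, ε) = (10, τ/160)`
  obtain ⟨lam, hlam_def⟩ : ∃ lam : ℝ, lam = 1 - τ / 40 := ⟨_, rfl⟩
  have hlam : 39 / 40 ≤ lam := by rw [hlam_def]; linarith
  have hlam1 : lam < 1 := by rw [hlam_def]; linarith
  have hlampos : 0 < lam := by linarith
  have H := H 10 (τ / 160) (by positivity)
  -- the lattice
  have hL0 := fcc_zero_mem (Real.sqrt (2 / 3))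
  have hLadd : ∀ p ∈ fccStacking 1 (Real.sqrt (2 / 3)), ∀ q ∈ fccStacking 1 (Real.sqrt (2 / 3)),
      p + q ∈ fccStacking 1 (Real.sqrt (2 / 3)) := fun p hp q hq => fcc_add_mem hp hq
  have hLsub : ∀ p ∈ fccStacking 1 (Real.sqrt (2 / 3)), ∀ q ∈ fccStacking 1 (Real.sqrt (2 / 3)),
      p - q ∈ fccStacking 1 (Real.sqrt (2 / 3)) := fun p hp q hq => fcc_sub_mem hp hq
  have hLshort : ∀ p ∈ fccStacking 1 (Real.sqrt (2 / 3)), ‖p‖ ^ 2 < 2 → p = 0 ∨ ‖p‖ = 1 :=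
    fun p hp h2 => fcc_short hp h2
  -- the finite chunk and its compressed enumeration
  obtain ⟨ρ₀, hρ₀⟩ : ∃ ρ₀ : ℝ, ρ₀ = max R' 0 / lam := ⟨_, rfl⟩
  obtain ⟨C, hC⟩ : ∃ C : Set (EuclideanSpace ℝ (Fin 3)), C = {c | c ∈ fccStacking 1 (Real.sqrt (2 / 3)) ∧ ‖c‖ ≤ ρ₀ + 2} :=
    ⟨_, rfl⟩
  have hCfin : C.Finite := by
    rw [hC]
    refine finite_of_forall_le_dist_of_subset_closedBall (δ := 4 / 5) (by norm_num)
      (fun p hp q hq hpq => fcc_sep hp.1 hq.1 hpq) (c := 0) (R := ρ₀ + 2) ?_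
    intro c hc
    simpa using hc.2
  obtain ⟨y, hy_def⟩ : ∃ y : Fin hCfin.toFinset.card → (EuclideanSpace ℝ (Fin 3)),
      y = fun k => lam • ((hCfin.toFinset.equivFin.symm k : ↥hCfin.toFinset) : (EuclideanSpace ℝ (Fin 3))) := ⟨_, rfl⟩
  have hyC : ∀ k, ((hCfin.toFinset.equivFin.symm k : ↥hCfin.toFinset) : (EuclideanSpace ℝ (Fin 3))) ∈ C := fun k =>
    hCfin.mem_toFinset.1 (hCfin.toFinset.equivFin.symm k).2
  have hCL : C ⊆ fccStacking 1 (Real.sqrt (2 / 3)) := by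
    rw [hC]
    exact fun c hc => hc.1
  have hy : ∀ k, ∃ c ∈ fccStacking 1 (Real.sqrt (2 / 3)), y k = lam • c := fun k =>
    ⟨_, hCL (hyC k), by rw [hy_def]⟩
  have hrange : ∀ zpt : (EuclideanSpace ℝ (Fin 3)), zpt ∈ Set.range y ↔ ∃ c ∈ C, zpt = lam • c := by
    intro zpt
    constructor
    · rintro ⟨k, rfl⟩
      exact ⟨_, hyC k, by rw [hy_def]⟩
    · rintro ⟨c, hc, rfl⟩
      refine ⟨hCfin.toFinset.equivFin ⟨c, hCfin.mem_toFinset.2 hc⟩, ?_⟩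
      rw [hy_def]
      simp only [Equiv.symm_apply_apply]
  have h0C : (0 : (EuclideanSpace ℝ (Fin 3))) ∈ C := by
    rw [hC]
    refine ⟨hL0, ?_⟩
    rw [norm_zero, hρ₀]
    positivity
  obtain ⟨i₀, hi₀⟩ : ∃ i₀ : Fin hCfin.toFinset.card,
      i₀ = hCfin.toFinset.equivFin ⟨0, hCfin.mem_toFinset.2 h0C⟩ := ⟨_, rfl⟩
  have hyi₀ : y i₀ = 0 := by
    rw [hy_def, hi₀]
    simp only [Equiv.symm_apply_apply, smul_zero]
  have hsep : ∀ k k' : Fin hCfin.toFinset.card, k ≠ k' → (1 / 2 : ℝ) ≤ dist (y k) (y k') := by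
    intro k k' hkk'
    have hne : ((hCfin.toFinset.equivFin.symm k : ↥hCfin.toFinset) : (EuclideanSpace ℝ (Fin 3))) ≠
        ((hCfin.toFinset.equivFin.symm k' : ↥hCfin.toFinset) : (EuclideanSpace ℝ (Fin 3))) := fun h =>
      hkk' (hCfin.toFinset.equivFin.symm.injective (Subtype.ext h))
    have h45 := fcc_sep (hCL (hyC k)) (hCL (hyC k')) hne
    rw [hy_def]
    simp only [dist_smul₀, Real.norm_eq_abs, abs_of_pos hlampos]
    nlinarith
  -- every site within `R'` of the centre `y i₀ = 0` is `τ`-good (fcc branch, identity isometry)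
  have hgood := fun j (hj : dist (y j) (y i₀) ≤ R') =>
    good_scaled (T' := {p : (EuclideanSpace ℝ (Fin 3)) | p ∈ hcpStacking 1 (Real.sqrt (2 / 3)) ∧ p ≠ 0 ∧ ‖p‖ < 13 / 10 * 1})
      hLadd hLsub hLshort (τ := τ) (r := 13 / 10 * 1) (ρ₀ := ρ₀) hlam hlam1.le
      (by rw [hlam_def]; nlinarith) (by norm_num) (by norm_num) hCL
      (by intro c hcL hcn; rw [hC]; exact ⟨hcL, by linarith⟩) hrange j
      (by
        rw [hyi₀, dist_zero_right] at hj
        rw [hρ₀, mul_div_cancel₀ _ hlampos.ne']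
        exact hj.trans (le_max_left _ _))
  obtain ⟨A, t, s, z, -, hz, hW⟩ := H hCfin.toFinset.card y hsep i₀ hgood
  have hz' : ∀ m : ℤ, 39 / 50 ≤ z (m + 1) - z m ∧ z (m + 1) - z m ≤ 17 / 20 := fun m => by
    simpa using hz m
  exact no_window hLsub hLshort hlam (by rw [hlam_def]; linarith) hy A t s z (le_refl 10)
    (exists_index_abs_le_one z hz') hW.1

end Summit.AtomisticToContinuum.Crystallization.Theorems.ShellsToLayers.Negative

end
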